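import Summits.QuantumFields.BalabanUV.T4Continuum.Support.NE7Route1EndDocked
import Summits.QuantumFields.BalabanUV.T4Continuum.Support.NE7EtaBackgroundFlatOrbit
import HarnessLib

/-!
# NE7Route1EndDockedFlatOrbit — route #1 of the NE7 crux (node U5): the docked END (`CruxDecl_of`'s seam END ∘ node T ∘ NODE O) with
# its (A)-bill DISCHARGED on the gauge orbit of the flat configuration — ONE theorem whose hypotheses are (B)(C)(D) and letters only

Cell `pub-balaban`, rung (B)+1 sub-cell t4, lineage `b2b-balaban-t4-ne7-p1`, generation 57 (CRUX PROVER NE7 #1, ruling e34b3e0c (2));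
crux skeleton `t4/skeletons/NE7-CRUX-R1.md` v1.7.16 §2 ∕ §3quattuordecies; companion of `Support/NE7EtaBackgroundFlatOrbit` (this generation).
HONEST FRAMING (page 1): FIXED FINITE T⁴, rung (B)+1; NE7 is the cell's OWN estimate, NOT PRINTED in
[Balaban1984PropagatorsI]–[Balaban1989LargeFieldII] and NOT PROVED here; continuum YM on T⁴ ⇐ BetaPertH ∧ nine spine estimates (0/9
proved); BetaPertH ⇐ (D1) ∧ (D4) ∧ CAP+tail; G-an2-4 gates asym, D1 and NE2/3/4; NOT infinite volume, NOT mass gap, NOT Clay.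

WHAT ([folklore] composition; 0 def; 0 sorry; ONE theorem application).  `NE7Route1EndDocked.goodClause_summable_of_route1_docked` (p317648)
concludes road P1's END shape `∃ δ, GoodClause l₀ vol T A B Bad δ ∧ Summable δ` from (A) the bill of NODE O's background coordinate on a
domain `dom` of data (`hdom`, NE3's (H∃) `hmin`, NE3's covariant root amendment 4 `h`, `v₁ ∈ dom`, letters), (B) node U2's output and the
window ∕ moduli letters, (C) node U3's shapes, (D) the term-wise END's own binders.  `Support/NE7EtaBackgroundFlatOrbit` DISCHARGES the
four (A)-hypotheses on `dom` = the unitary `N`-periodic gauge orbit of the flat configuration (`gaugeAct_mem_flatOrbit`, `hmin_flatOrbit`,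
`covRoot_flatOrbit` with `Z = 0`, `flatCfg_mem_flatOrbit`).  **`goodClause_summable_of_route1_docked_flatOrbit`** is the docked END with
those four binders REPLACED by the equation `dom = {1^{w} : w unitary, N-periodic}` and the four sign letters the discharge needs
(`0 ≤ c`, `0 ≤ C`, `0 ≤ Λ₁`, `0 ≤ Λ₂′` — necessary anyway: with `c < 0` no configuration is `RegularSup`, with `C < 0` no direction has
energy `≤ C·residualScale`), the reference datum being the flat configuration itself (`v₁ := 1`); every (B)(C)(D) binder VERBATIM.  So on
the base point of the background coordinate the composition END ∘ node T ∘ NODE O asks NOTHING of row NE3: what remains there is node U2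
(B), node U3 (C) and NODE O's functional half + the one-run shapes (D).  The positional plug was first checked as a scratch probe
(`t4/b2b-balaban-t4-ne7-p1-g57/rec/ProbeFlatOrbitPlug.NOT-TO-FILE.lean`, rc 0).  ALSO **`minimiser_unique_mod_gauge_flatOrbit`**: any two
run-`k` minimisers of a datum of the flat orbit differ by a unitary `(N·L^k)`-periodic gauge — the base-point case of the uniqueness clause that
generation 56's located (β) would otherwise put on X-A2's bill (its functionals are read at EVERY selection of minimisers).
HONEST: a NON-VACUITY ∕ BASE-POINT statement — the flat orbit carries no curvature, the discrepancy direction is `0`, and nothing is said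
at a non-flat datum, where NE3's root and (H∃) remain HYPOTHESES (X-A4, unseated); every (B)(C)(D) input is a hypothesis shape asserted
for nothing; nothing printed is asserted; route 1 stays KERNEL-COMPLETE AT FORM LEVEL ∕ DEPENDENT; NE7 NOT proved; spine 0∕9.
-/

set_option autoImplicit false

open scoped BigOperators Matrix Matrix.Norms.L2Operator
open Finset NormedSpace MeasureTheory

namespace Summit.QuantumFields.BalabanUV.T4Continuum.NE7Route1EndDockedFlatOrbit

open Literature.MathematicalPhysics.QuantumFieldTheory.Balaban1983to89
open B7Prop1Explicit B7Prop2Explicit B7Prop1Local B11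
open T4AveragingDeficitWall hiding Site Plane Plaq Bond
open T4AveragingDeficitWallBoundary (periodBox IsPeriodicCfg)
open MinimalActionSandwich (IsMinimiser)
open MinimalActionRate (Regular sfClass)
open MinimalActionRefine (RegularSup gradConst)
open MinimalActionWitness (flatCfg)
open T4OutputRate (Carriers Functional NE9 NE5 LipBackground FadingMemory)
open T4BoundaryCarrier (BFunctional atFl NE9Fl LipBackgroundFl NE5B)
open T4TowerRateComposition (PolyLipGrowth URateUpTo)
open T4CauchySum (InjectedRate)
open T4RecentScale T4GoodClassBudget T4TermwiseBudget T4TermwiseUN T4TermwiseChainUN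
open AveragingDeficitPeriodicCounting (IsPeriodicDir)
open AveragingDeficitTwoLevelPrep (twoLevelSmall)
open NE3EnergyShapes (residualScale IsUnitarySite IsPeriodicSite)
open NE3EnergyWeightedShapes (energyNormW)
open NE7EtaBackgroundCarrier
open TorusSmallFieldGlobalGauge (sectorConst)
open TermwiseBackground (cReg)
open TermwiseHolder (Realises)
open T4TermwiseTorus (IsPeriodic pbox)
open NE7Route1EndDocked (goodClause_summable_of_route1_docked)
open NE7EtaBackgroundFlatOrbit (gaugeAct_mem_flatOrbit flatCfg_mem_flatOrbit hmin_flatOrbit covRoot_flatOrbit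
  exists_periodic_gauge_of_isMinimiser_flatOrbit)

noncomputable section

variable {n : Type} [Fintype n] [DecidableEq n] [Nonempty n]

/-- **UNIQUENESS MODULO PERIODIC GAUGE ON THE FLAT ORBIT** (the base-point case of [Balaban1985Variational] Thm 1's uniqueness clause,
which NODE O's functional half would otherwise have to put on the bill — located (β) of generation 56: the END's format binders are asked
for EVERY selection of minimisers, so X-A2's functionals must not see WHICH minimiser was selected): any two run-`k` minimisers in
`sfClass ε` of a datum `1^{w}` of the flat orbit (`w` unitary, `N`-periodic; `L, N ≥ 1`, `ε ≥ 0`) differ by a unitary `(N·L^k)`-periodic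
gauge transformation — both are periodic pure gauges (`NE7EtaBackgroundFlatOrbit.exists_periodic_gauge_of_isMinimiser_flatOrbit`).
[folklore] -/
theorem minimiser_unique_mod_gauge_flatOrbit {L N : ℕ} (hL : 1 ≤ L) (hN : 1 ≤ N) {ε : ℝ} (hε : 0 ≤ ε)
    {w : Site 4 → (Matrix n n ℂ)ˣ} (hwu : IsUnitarySite w) (hwp : IsPeriodicSite w (N : ℤ)) {k : ℕ}
    {U U' : Site 4 → Fin 4 → (Matrix n n ℂ)ˣ} (hU : IsMinimiser 4 (sfClass 4 L N ε) L N k (gaugeAct w flatCfg) U)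
    (hU' : IsMinimiser 4 (sfClass 4 L N ε) L N k (gaugeAct w flatCfg) U') :
    ∃ u : Site 4 → (Matrix n n ℂ)ˣ, IsUnitarySite u ∧ IsPeriodicSite u ((N * L ^ k : ℕ) : ℤ) ∧ U' = gaugeAct u U := by
  obtain ⟨g, hgu, hgp, rfl⟩ := exists_periodic_gauge_of_isMinimiser_flatOrbit hL hN hε hwu hwp hU
  obtain ⟨g', hg'u, hg'p, rfl⟩ := exists_periodic_gauge_of_isMinimiser_flatOrbit hL hN hε hwu hwp hU'
  refine ⟨fun x => g' x * (g x)⁻¹,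
    fun x => (unitaryUnits (Matrix n n ℂ)).mul_mem (hg'u x) ((unitaryUnits (Matrix n n ℂ)).inv_mem (hgu x)),
    fun x i => by simp only [hgp x i, hg'p x i], ?_⟩
  funext x μ
  simp only [gaugeAct, flatCfg, mul_one, mul_inv_rev, inv_inv]
  group

/-- **ROUTE #1's DOCKED END ON THE FLAT ORBIT — the (A)-bill discharged.**  `NE7Route1EndDocked.goodClause_summable_of_route1_docked` with
`dom` = the unitary `N`-periodic gauge orbit of the flat configuration and reference datum `1`: its hypotheses `hdom`, (H∃) `hmin`, NE3's
covariant root amendment 4 `h` and `hv₁` are SUPPLIED by `NE7EtaBackgroundFlatOrbit` (`Z = 0`), at the price of the sign letters `0 ≤ c`,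
`0 ≤ C`, `0 ≤ Λ₁`, `0 ≤ Λ₂′`; parts (B) node U2, (C) node U3, (D) the term-wise END's own binders are VERBATIM; conclusion
`∃ δ, GoodClause l₀ vol T A B Bad δ ∧ Summable δ`.  Base point only; every remaining input is a hypothesis shape; NOT NE7. [folklore] -/
theorem goodClause_summable_of_route1_docked_flatOrbit
    -- (A) the letters of NODE O's background coordinate; `dom` = the flat orbit; the four sign letters the discharge needs
    {L N : ℕ} (hL : 2 ≤ L) (hN : 1 ≤ N) {θ : ℝ} (hθ : 0 < θ)
    (hθ6 : θ ^ 6 = ((L : ℝ))⁻¹) {ε b c : ℝ} (hb : 0 ≤ b) (hbε : b ≤ ε)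
    (hbs : 512 * (4 + 1) * (4 + 4) * (L : ℝ) ^ 2 * b ≤ 1)
    (hε1 : 16 * C0 4 * ε ≤ 3) (h2line : 2 * twoLevelSmall 4 L * ε ≤ (L : ℝ) ^ 2)
    {g C Λ₁ Λ₂' : ℝ} (hgc : gradConst 4 c ≤ g)
    {dom : Set (Site 4 → Fin 4 → (Matrix n n ℂ)ˣ)}
    (hflat : dom = {v : Site 4 → Fin 4 → (Matrix n n ℂ)ˣ | ∃ w : Site 4 → (Matrix n n ℂ)ˣ,
        IsUnitarySite w ∧ IsPeriodicSite w (N : ℤ) ∧ v = gaugeAct w flatCfg})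
    (hc : 0 ≤ c) (hC : 0 ≤ C) (hΛ₁ : 0 ≤ Λ₁) (hΛ₂' : 0 ≤ Λ₂')
    (hsector : (Fintype.card n : ℝ) * (N : ℝ) ^ 2 * ε ≤ sectorConst n)
    (D : Type) (sc : D → ℕ) (dl : D → ℝ) (hdl : ∀ X, 0 ≤ dl X) (Fl : Type) (admFl : Set Fl)
    -- (B) window, decay, history moduli, node U2's output on the printed box, the common rate `θ′ ∈ [θ, 1)`
    {W : Set (ℕ → ℝ)} {κ C₉ ω θc Cd γg θ' : ℝ} {Λ : ℕ → ℕ → ℝ} {gA : ℕ → ℕ → ℝ}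
    (hΛ : FadingMemory C₉ ω Λ) (hω : 0 ≤ ω)
    (hinj : InjectedRate Cd 0 θc (fun K j => T4CouplingMatching.disc (gA K) (gA (K + 1)) j)) (hCd : 0 ≤ Cd)
    (hθc : 0 ≤ θc) (hbox : ∀ K i, i ≤ K → 0 < gA K i ∧ gA K i ≤ γg)
    (hgAW : ∀ K, gA K ∈ W) (hgBW : ∀ K, (fun i => gA (K + 1) (i + 1)) ∈ W)
    (hθ' : max ω θc < θ') (hθθ' : θ ≤ θ') (hθ'1 : θ' < 1)
    -- (C) node U3's shapes: E-kind `EA EB`, boundary kind `BA BB`, 𝐑-kind `RA RB` on the boundary carrier over `occCarriers`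
    {EA : Functional ({ toCarriers := occCarriers n L N ε dom D sc dl hdl, Fl := Fl, admFl := admFl } :
        T4BoundaryCarrier.Carriers).toCarriers (occCarriers n L N ε dom D sc dl hdl).BgA}
    {EB : Functional ({ toCarriers := occCarriers n L N ε dom D sc dl hdl, Fl := Fl, admFl := admFl } :
        T4BoundaryCarrier.Carriers).toCarriers (occCarriers n L N ε dom D sc dl hdl).BgB}
    {θ₅ C₅ P : ℝ} {q : ℕ} {CU : (ℕ → ℝ) → ℕ → ℝ}
    (h9 : NE9 EA W κ Λ) (hU : LipBackground EA W κ CU) (hG : PolyLipGrowth CU gA P q) (hP : 0 ≤ P)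
    (h5 : NE5 EA EB W κ θ₅ C₅) (hθ₅ : 0 ≤ θ₅) (hC₅ : 0 ≤ C₅) (hθ₅' : θ₅ ≤ θ')
    {BA : BFunctional ({ toCarriers := occCarriers n L N ε dom D sc dl hdl, Fl := Fl, admFl := admFl } : T4BoundaryCarrier.Carriers)
        (occCarriers n L N ε dom D sc dl hdl).BgA}
    {BB : BFunctional ({ toCarriers := occCarriers n L N ε dom D sc dl hdl, Fl := Fl, admFl := admFl } : T4BoundaryCarrier.Carriers)
        (occCarriers n L N ε dom D sc dl hdl).BgB}
    {θ₅B C₅B PB : ℝ} {qB : ℕ} {CUB : (ℕ → ℝ) → ℕ → ℝ}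
    (h9B : NE9Fl BA W κ Λ) (hUBf : LipBackgroundFl BA W κ CUB) (hGB : PolyLipGrowth CUB gA PB qB) (hPB : 0 ≤ PB)
    (h5B : NE5B BA BB W κ θ₅B C₅B) (hθ₅B : 0 ≤ θ₅B) (hC₅B : 0 ≤ C₅B) (hθ₅B' : θ₅B ≤ θ')
    {RA : Functional ({ toCarriers := occCarriers n L N ε dom D sc dl hdl, Fl := Fl, admFl := admFl } :
        T4BoundaryCarrier.Carriers).toCarriers (occCarriers n L N ε dom D sc dl hdl).BgA}
    {RB : Functional ({ toCarriers := occCarriers n L N ε dom D sc dl hdl, Fl := Fl, admFl := admFl } :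
        T4BoundaryCarrier.Carriers).toCarriers (occCarriers n L N ε dom D sc dl hdl).BgB}
    {θ₅R C₅R PR : ℝ} {qR : ℕ} {CUR : (ℕ → ℝ) → ℕ → ℝ}
    (h9R : NE9 RA W κ Λ) (hUR' : LipBackground RA W κ CUR) (hGR : PolyLipGrowth CUR gA PR qR) (hPR : 0 ≤ PR)
    (h5R : NE5 RA RB W κ θ₅R C₅R) (hθ₅R : 0 ≤ θ₅R) (hC₅R : 0 ≤ C₅R) (hθ₅R' : θ₅R ≤ θ')
    -- (D) the term-wise END's own data and remaining binders (`TermwiseLocalThm1LedgerW` ll.97–242, `ι :=` configurations, `Adm := dom`)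
    [MeasurableSpace (Site 4 → Fin 4 → (Matrix n n ℂ)ˣ)] {σ : Type*} [DecidableEq σ] {l₀ vol : ℝ}
    {T : ℕ → Finset σ} {Bad : ℕ → ℝ → Finset σ} {A B : ℕ → ℝ → σ → ℝ} {μ : ℕ → ℝ → σ → Measure (Site 4 → Fin 4 → (Matrix n n ℂ)ˣ)}
    {fac bfac rfac : ℕ → ℝ → σ → Finset D} {R₁ bβ β' w₀ : ℝ} {κ₀ : ℕ} {gfA gfB : ℕ → ℝ} {gsA gsB : ℕ → ℕ → ℝ}
    {pend : ℕ → ℝ → σ → (Site 4 → Fin 4 → (Matrix n n ℂ)ˣ) → Fl}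
    {nA nB aA aB wA wB γA γB : ℕ → ℝ → σ → (Site 4 → Fin 4 → (Matrix n n ℂ)ˣ) → ℝ} {qA qB : ℕ → ℝ}
    {κ₁ S : ℕ → ℝ → σ → ℕ → ℝ} {cW' RW' : ℕ → ℝ → σ → ℝ} {rw' sw' rγ zA zB c₀' : ℕ → ℝ} {Cw E a Λg Cl CF Ew CrW : ℝ}
    {Y YA : Type*} {Sfib : ℕ → ℝ → σ → (Site 4 → Fin 4 → (Matrix n n ℂ)ˣ) → Set Y}
    {SfibA : ℕ → ℝ → σ → (Site 4 → Fin 4 → (Matrix n n ℂ)ˣ) → Set YA} {gfib : ℕ → ℝ → σ → (Site 4 → Fin 4 → (Matrix n n ℂ)ˣ) → YA → ℝ}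
    {f₁ : ℕ → ℝ → σ → (Site 4 → Fin 4 → (Matrix n n ℂ)ˣ) → Y → ℝ}
    {Q : ℕ → ℝ → σ → (Site 4 → Fin 4 → (Matrix n n ℂ)ˣ) → Y → YA} {yA yB : ℕ → ℝ → σ → (Site 4 → Fin 4 → (Matrix n n ℂ)ˣ) → Y}
    {xA : ℕ → ℝ → σ → (Site 4 → Fin 4 → (Matrix n n ℂ)ˣ) → YA}
    (M : ℕ) (hMtwo : 2 ≤ M) (planes : Finset (Fin 4 × Fin 4))
    (hplanes : ∀ P ∈ planes, P.1 ≠ P.2)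
    (famA famB : ℕ → ℝ → σ → (Site 4 → Fin 4 → (Matrix n n ℂ)ˣ) → VarProblem)
    (ρA : ∀ K t τ v, Realises (famA K t τ v) 4 (Matrix n n ℂ)) (ρB : ∀ K t τ v, Realises (famB K t τ v) 4 (Matrix n n ℂ))
    (UA : ∀ K t τ v, (famA K t τ v).Cfg) (UB : ∀ K t τ v, (famB K t τ v).Cfg)
    (lvlA lvlB : ℕ → ℝ → σ → (Site 4 → Fin 4 → (Matrix n n ℂ)ˣ) → (Fin 4 × Fin 4) × B7Prop1Explicit.Site 4 → ℕ)
    (Cst : B11Thm1.Consts) {Mc ε₁ β₀ : ℝ}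
    (hθ'Λ : θ' ≤ Λg) (hΛ1 : 1 ≤ Λg) (hCl : 0 ≤ Cl)
    -- the residue of the residual-proper factor (W-fmt), read by `hWw′` below
    (wA' wB' : ℕ → ℝ → σ → (Site 4 → Fin 4 → (Matrix n n ℂ)ˣ) → ℝ)
    -- THE EIGHT SELECTION-READING BINDERS, for EVERY selection with the gen-56 specification
    (hO : ∀ (uA : ℕ → (Site 4 → Fin 4 → (Matrix n n ℂ)ˣ) → (occCarriers n L N ε dom D sc dl hdl).BgA)
        (uB : ℕ → (Site 4 → Fin 4 → (Matrix n n ℂ)ˣ) → (occCarriers n L N ε dom D sc dl hdl).BgB)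
        (oneA : (occCarriers n L N ε dom D sc dl hdl).BgA) (oneB : (occCarriers n L N ε dom D sc dl hdl).BgB),
      -- (a) gauge copies of a minimiser pair for the datum itself, at EVERY cutoff, on `dom ∖ {1}`
      (∀ K : ℕ, ∀ v ∈ dom, v ≠ flatCfg → ∃ (U₁ U₂ : (Site 4 → Fin 4 → (Matrix n n ℂ)ˣ)) (w₁ w₂ : Site 4 → (Matrix n n ℂ)ˣ),
        IsMinimiser 4 (sfClass 4 L N ε) L N K v U₁ ∧ IsMinimiser 4 (sfClass 4 L N ε) L N (K + 1) v U₂ ∧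
        Regular 4 L N b g (K + 1) U₂ ∧ IsUnitarySite w₁ ∧ IsPeriodicSite w₁ ((N * L ^ K : ℕ) : ℤ) ∧
        IsUnitarySite w₂ ∧ IsPeriodicSite w₂ ((N * L ^ (K + 1) : ℕ) : ℤ) ∧
        (uA K v).1 = (K, gaugeAct w₁ U₁) ∧ (uB K v).1 = (K, gaugeAct w₂ U₂)) →
      -- (b) the reference backgrounds at `1` and off `dom`; they are the flat configuration at tag `0`
      (∀ (K : ℕ) (v : (Site 4 → Fin 4 → (Matrix n n ℂ)ˣ)), ¬ (v ∈ dom ∧ v ≠ flatCfg) → uA K v = oneA ∧ uB K v = oneB) →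
      oneA.1 = ((0 : ℕ), (1 : Site 4 → Fin 4 → (Matrix n n ℂ)ˣ)) → oneB.1 = ((0 : ℕ), (1 : Site 4 → Fin 4 → (Matrix n n ℂ)ˣ)) →
      -- `hfmtA` (l.97)
      (∀ K t τ, A K t τ = ∫ v, (∏ X ∈ fac K t τ,
        Real.exp (EA (gA K) (uA K v) X - EA (gA K) oneA X)) *
          ((∏ X ∈ bfac K t τ, Real.exp (BA (gA K) (uA K v) (pend K t τ v) X)) * nA K t τ v * qA K *
            ((∏ X ∈ rfac K t τ, Real.exp (RA (gA K) (uA K v) X - RA (gA K) oneA X)) * (Real.exp (-aA K t τ v) * wA K t τ v)))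
            ∂(μ K t τ)) ∧
      -- `hfmtB` (l.102)
      (∀ K t τ, B K t τ = ∫ v, (∏ X ∈ fac K t τ,
        Real.exp (EB (fun i => gA (K + 1) (i + 1)) (uB K v) X - EB (fun i => gA (K + 1) (i + 1)) oneB X)) *
          ((∏ X ∈ bfac K t τ, Real.exp (BB (fun i => gA (K + 1) (i + 1)) (uB K v) (pend K t τ v) X)) * nB K t τ v * qB K *
            ((∏ X ∈ rfac K t τ, Real.exp (RB (fun i => gA (K + 1) (i + 1)) (uB K v) X - RB (fun i => gA (K + 1) (i + 1)) oneB X)) *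
              (Real.exp (-aB K t τ v) * wB K t τ v)))
            ∂(μ K t τ)) ∧
      -- `hint` (l.107)
      (∀ K t, |t| ≤ l₀ → ∀ τ ∈ T K \ Bad K t,
        Integrable (fun v => (∏ X ∈ fac K t τ, Real.exp (EA (gA K) (uA K v) X - EA (gA K) oneA X)) *
          ((∏ X ∈ bfac K t τ, Real.exp (BA (gA K) (uA K v) (pend K t τ v) X)) * nA K t τ v * qA K *
            ((∏ X ∈ rfac K t τ, Real.exp (RA (gA K) (uA K v) X - RA (gA K) oneA X)) * (Real.exp (-aA K t τ v) * wA K t τ v))))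
            (μ K t τ) ∧
        Integrable (fun v => (∏ X ∈ fac K t τ,
            Real.exp (EB (fun i => gA (K + 1) (i + 1)) (uB K v) X - EB (fun i => gA (K + 1) (i + 1)) oneB X)) *
          ((∏ X ∈ bfac K t τ, Real.exp (BB (fun i => gA (K + 1) (i + 1)) (uB K v) (pend K t τ v) X)) * nB K t τ v * qB K *
            ((∏ X ∈ rfac K t τ, Real.exp (RB (fun i => gA (K + 1) (i + 1)) (uB K v) X - RB (fun i => gA (K + 1) (i + 1)) oneB X)) *
              (Real.exp (-aB K t τ v) * wB K t τ v))))
            (μ K t τ)) ∧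
      -- `hoff` (l.117)
      (∀ K t, |t| ≤ l₀ → ∀ τ ∈ T K \ Bad K t, ∀ v, v ∉ dom →
        (∏ X ∈ fac K t τ, Real.exp (EA (gA K) (uA K v) X - EA (gA K) oneA X)) *
          ((∏ X ∈ bfac K t τ, Real.exp (BA (gA K) (uA K v) (pend K t τ v) X)) * nA K t τ v * qA K *
            ((∏ X ∈ rfac K t τ, Real.exp (RA (gA K) (uA K v) X - RA (gA K) oneA X)) * (Real.exp (-aA K t τ v) * wA K t τ v)))
            = 0 ∧
        (∏ X ∈ fac K t τ, Real.exp (EB (fun i => gA (K + 1) (i + 1)) (uB K v) X - EB (fun i => gA (K + 1) (i + 1)) oneB X)) *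
          ((∏ X ∈ bfac K t τ, Real.exp (BB (fun i => gA (K + 1) (i + 1)) (uB K v) (pend K t τ v) X)) * nB K t τ v * qB K *
            ((∏ X ∈ rfac K t τ, Real.exp (RB (fun i => gA (K + 1) (i + 1)) (uB K v) X - RB (fun i => gA (K + 1) (i + 1)) oneB X)) *
              (Real.exp (-aB K t τ v) * wB K t τ v)))
            = 0) ∧
      -- `hS` (l.126)
      (∀ K t, |t| ≤ l₀ → ∀ τ ∈ T K \ Bad K t, ∀ v ∈ dom, ∀ j ≤ K,
        |(∑ X ∈ fac K t τ with sc X = j,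
            (Real.log (Real.exp (EB (fun i => gA (K + 1) (i + 1)) (uB K v) X - EB (fun i => gA (K + 1) (i + 1)) oneB X))
              - Real.log (Real.exp (EA (gA K) (uA K v) X - EA (gA K) oneA X)))) - κ₁ K t τ j| ≤ S K t τ j) ∧
      -- `hRSA` (l.148), `hRSB` (l.150)
      (∀ K t, |t| ≤ l₀ → ∀ τ ∈ T K \ Bad K t, ∀ v ∈ dom, ∀ j ≤ K,
        |∑ X ∈ rfac K t τ with sc X = j, (RA (gA K) (uA K v) X - RA (gA K) oneA X)| ≤ vol * (R₁ * gsA K j ^ κ₀)) ∧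
      (∀ K t, |t| ≤ l₀ → ∀ τ ∈ T K \ Bad K t, ∀ v ∈ dom, ∀ j ≤ K,
        |∑ X ∈ rfac K t τ with sc X = j,
          (RB (fun i => gA (K + 1) (i + 1)) (uB K v) X - RB (fun i => gA (K + 1) (i + 1)) oneB X)| ≤ vol * (R₁ * gsB K j ^ κ₀)) ∧
      -- `hWw′` (l.222)
      (∀ K t, |t| ≤ l₀ → ∀ τ ∈ T K \ Bad K t, ∀ v ∈ dom, uA K v = oneA → uB K v = oneB →
        |Real.log (wB' K t τ v) - Real.log (wA' K t τ v) - c₀' K| ≤ vol * sw' K))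
    -- the END's selection-free binders, VERBATIM
    (hsc : ∀ K t, |t| ≤ l₀ → ∀ τ ∈ T K \ Bad K t, ∀ X ∈ fac K t τ, sc X ≤ K)
    (hM : ∀ K t, |t| ≤ l₀ → ∀ τ ∈ T K \ Bad K t,
      Multiplicity (fac K t τ) sc (fun X => Real.exp (-(κ * dl X))) Cw vol Λg K)
    (hvol : 0 ≤ vol) (hE : 0 ≤ E) (ha0 : 0 < a) (ha1 : a < 1)
    (hSle : ∀ K t, |t| ≤ l₀ → ∀ τ ∈ T K \ Bad K t, ∀ j ≤ K, S K t τ j ≤ vol * (E * a ^ (K - j)))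
    (hpend : ∀ K t, |t| ≤ l₀ → ∀ τ ∈ T K \ Bad K t, ∀ v ∈ dom, pend K t τ v ∈ admFl)
    (hBwin : ∀ K t, |t| ≤ l₀ → ∀ τ ∈ T K \ Bad K t, RecentOnly (bfac K t τ) sc (jlogOf Cl K) K)
    (hMB : ∀ K t, |t| ≤ l₀ → ∀ τ ∈ T K \ Bad K t,
      Multiplicity (bfac K t τ) sc (fun X => Real.exp (-(κ * dl X))) Cw vol Λg K)
    (hnpos : ∀ K t, |t| ≤ l₀ → ∀ τ ∈ T K \ Bad K t, ∀ v ∈ dom, 0 < nA K t τ v ∧ 0 < nB K t τ v)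
    (hzA : ∀ K t, |t| ≤ l₀ → ∀ τ ∈ T K \ Bad K t, ∀ v ∈ dom, |Real.log (nA K t τ v)| ≤ vol * zA K)
    (hzB : ∀ K t, |t| ≤ l₀ → ∀ τ ∈ T K \ Bad K t, ∀ v ∈ dom, |Real.log (nB K t τ v)| ≤ vol * zB K)
    (hzAs : Summable zA) (hzBs : Summable zB)
    (hq : ∀ K, 0 < qA K ∧ 0 < qB K)
    (hrsc : ∀ K t, |t| ≤ l₀ → ∀ τ ∈ T K \ Bad K t, ∀ X ∈ rfac K t τ, sc X ≤ K)
    (hMR : ∀ K t, |t| ≤ l₀ → ∀ τ ∈ T K \ Bad K t,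
      Multiplicity (rfac K t τ) sc (fun X => Real.exp (-(κ * dl X))) Cw vol Λg K)
    (hbβ : 0 < bβ) (h031A : ∀ K, Step.Discrete031 bβ β' K (gfA K) (gsA K))
    (h031B : ∀ K, Step.Discrete031 bβ β' K (gfB K) (gsB K)) (hgsA : ∀ K k, k ≤ K → 0 ≤ gsA K k)
    (hgsB : ∀ K k, k ≤ K → 0 ≤ gsB K k) (hR₁ : 0 ≤ R₁) (hκ₀ : 4 < κ₀)
    (hminA : ∀ K t, |t| ≤ l₀ → ∀ τ ∈ T K \ Bad K t, ∀ v ∈ dom, IsMinOn (gfib K t τ v) (SfibA K t τ v) (xA K t τ v))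
    (hQ : ∀ K t, |t| ≤ l₀ → ∀ τ ∈ T K \ Bad K t, ∀ v ∈ dom, Set.MapsTo (Q K t τ v) (Sfib K t τ v) (SfibA K t τ v))
    (hlift : ∀ K t, |t| ≤ l₀ → ∀ τ ∈ T K \ Bad K t, ∀ v ∈ dom,
      yA K t τ v ∈ Sfib K t τ v ∧ Q K t τ v (yA K t τ v) = xA K t τ v)
    (hminB : ∀ K t, |t| ≤ l₀ → ∀ τ ∈ T K \ Bad K t, ∀ v ∈ dom,
      yB K t τ v ∈ Sfib K t τ v ∧ IsMinOn (f₁ K t τ v) (Sfib K t τ v) (yB K t τ v))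
    (hact : ∀ K t, |t| ≤ l₀ → ∀ τ ∈ T K \ Bad K t, ∀ v ∈ dom,
      aA K t τ v = w₀ * gfib K t τ v (xA K t τ v) + γA K t τ v ∧
        aB K t τ v = w₀ * f₁ K t τ v (yB K t τ v) + γB K t τ v)
    (hw₀ : 0 ≤ w₀)
    (hAU : ∀ K t, |t| ≤ l₀ → ∀ τ ∈ T K \ Bad K t, ∀ v ∈ dom,
      (∀ x κ, (ρA K t τ v).cfg (UA K t τ v) x κ ∈ unitaryUnits (Matrix n n ℂ)) ∧
        IsPeriodic (M * L ^ K * L) ((ρA K t τ v).cfg (UA K t τ v)))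
    (hBU : ∀ K t, |t| ≤ l₀ → ∀ τ ∈ T K \ Bad K t, ∀ v ∈ dom,
      (∀ x κ, (ρB K t τ v).cfg (UB K t τ v) x κ ∈ unitaryUnits (Matrix n n ℂ)) ∧
        IsPeriodic (M * L ^ K * L) ((ρB K t τ v).cfg (UB K t τ v)))
    (hPLA : ∀ K t τ v, (famA K t τ v).L = (L : ℝ)) (hetaA : ∀ K t τ v, (famA K t τ v).eta = ((L : ℝ) ^ K)⁻¹)
    (hPLB : ∀ K t τ v, (famB K t τ v).L = (L : ℝ)) (hetaB : ∀ K t τ v, (famB K t τ v).eta = ((L : ℝ) ^ K)⁻¹)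
    (hTA : ∀ K t τ v, B11Thm1.Thm1At Cst (famA K t τ v)) (hTB : ∀ K t τ v, B11Thm1.Thm1At Cst (famB K t τ v))
    (hε₁a : ε₁ ≤ Cst.a₁) (VbA : ∀ K t τ v, (famA K t τ v).Bdry) (VbB : ∀ K t τ v, (famB K t τ v).Bdry)
    (hVbA : ∀ K t τ v, (famA K t τ v).Reg7 ε₁ (VbA K t τ v)) (hVbB : ∀ K t τ v, (famB K t τ v).Reg7 ε₁ (VbB K t τ v))
    (hUA : ∀ K t τ v, (famA K t τ v).OnMinimalOrbit (Cst.B₃ * ε₁) (VbA K t τ v) (UA K t τ v))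
    (hUB : ∀ K t τ v, (famB K t τ v).OnMinimalOrbit (Cst.B₃ * ε₁) (VbB K t τ v) (UB K t τ v))
    (hMc0 : 0 ≤ Mc) (hMc : Mc ≤ Cst.Mfun ε₁)
    (hlvlA : ∀ K t τ v, ∀ y ∈ pbox planes (M * L ^ K), lvlA K t τ v y ≤ K)
    (hlvlB : ∀ K t τ v, ∀ y ∈ pbox planes (M * L ^ K), lvlB K t τ v y ≤ K)
    (hcoverA : ∀ K t, |t| ≤ l₀ → ∀ τ ∈ T K \ Bad K t, ∀ v ∈ dom, ∀ y ∈ pbox planes (M * L ^ K),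
      ∀ x : B7Prop1Explicit.Site 4, InBox ((L : ℤ) • y.2) (deltaHi L ((L : ℤ) • y.2) y.1.1 y.1.2) x →
        ∃ cb : (famA K t τ v).Cube, (famA K t τ v).scale cb = lvlA K t τ v y ∧ (famA K t τ v).sizeM cb ≤ Mc ∧
          l1 (x - (ρA K t τ v).centre cb) + 6 ≤ (ρA K t τ v).radius cb)
    (hcoverB : ∀ K t, |t| ≤ l₀ → ∀ τ ∈ T K \ Bad K t, ∀ v ∈ dom, ∀ y ∈ pbox planes (M * L ^ K),
      ∀ x : B7Prop1Explicit.Site 4, InBox ((L : ℤ) • y.2) (deltaHi L ((L : ℤ) • y.2) y.1.1 y.1.2) x →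
        ∃ cb : (famB K t τ v).Cube, (famB K t τ v).scale cb = lvlB K t τ v y ∧ (famB K t τ v).sizeM cb ≤ Mc ∧
          l1 (x - (ρB K t τ v).centre cb) + 6 ≤ (ρB K t τ v).radius cb)
    (hwinA : ∀ K t, |t| ≤ l₀ → ∀ τ ∈ T K \ Bad K t, ∀ v ∈ dom,
      RecentOnly (pbox planes (M * L ^ K)) (lvlA K t τ v) (jlogOf Cl K) K)
    (hwinB : ∀ K t, |t| ≤ l₀ → ∀ τ ∈ T K \ Bad K t, ∀ v ∈ dom,
      RecentOnly (pbox planes (M * L ^ K)) (lvlB K t τ v) (jlogOf Cl K) K)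
    (hε₁ : 0 < ε₁) (hε₁1 : ε₁ ≤ 1)
    (hsmall : 20480 * (L : ℝ) ^ 2 * (cReg (Cst.B₃ * Mc) (Cst.B₃ * Mc) * ε₁) ≤ 1) (hβ₀ : 0 < β₀) (hβ₀1 : β₀ ≤ 1)
    (hreprU : ∀ K t, |t| ≤ l₀ → ∀ τ ∈ T K \ Bad K t, ∀ v ∈ dom,
      f₁ K t τ v (yA K t τ v) = ∑ x ∈ pbox planes (M * L ^ K * L), eN (phiU ((ρA K t τ v).cfg (UA K t τ v)) x) ∧
        gfib K t τ v (xA K t τ v) = ∑ y ∈ pbox planes (M * L ^ K), eN (psiU L ((ρA K t τ v).cfg (UA K t τ v)) y))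
    (hreprL : ∀ K t, |t| ≤ l₀ → ∀ τ ∈ T K \ Bad K t, ∀ v ∈ dom,
      f₁ K t τ v (yB K t τ v) = ∑ x ∈ pbox planes (M * L ^ K * L), eN (phiU ((ρB K t τ v).cfg (UB K t τ v)) x) ∧
        gfib K t τ v (Q K t τ v (yB K t τ v)) = ∑ y ∈ pbox planes (M * L ^ K), eN (psiU L ((ρB K t τ v).cfg (UB K t τ v)) y))
    (hMvol : ((M : ℝ)) ^ 4 ≤ vol)
    (hγ : ∀ K t, |t| ≤ l₀ → ∀ τ ∈ T K \ Bad K t, ∀ v ∈ dom, |γB K t τ v - γA K t τ v| ≤ vol * rγ K)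
    (hrγ : Summable rγ)
    -- the residual-proper factor's format (W-fmt) and inputs (W-sc)(W-loc)(W-size)(W-rate-t)(W-mult-F)(W-win)(W-rate-0)(W-mult)
    (wfac nf : ℕ → ℝ → σ → Finset D) (wfac₀ : ℕ → Finset D)
    (vcA vcB : ℕ → ℝ → D → ℝ) (hEw : 0 ≤ Ew) (hCrW : 0 ≤ CrW)
    (hwA : ∀ K t, |t| ≤ l₀ → ∀ τ ∈ T K \ Bad K t, ∀ v ∈ dom,
      wA K t τ v = wA' K t τ v * Real.exp (∑ X ∈ wfac K t τ, vcA K t X))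
    (hwB : ∀ K t, |t| ≤ l₀ → ∀ τ ∈ T K \ Bad K t, ∀ v ∈ dom,
      wB K t τ v = wB' K t τ v * Real.exp (∑ X ∈ wfac K t τ, vcB K t X))
    (hw'pos : ∀ K t, |t| ≤ l₀ → ∀ τ ∈ T K \ Bad K t, ∀ v ∈ dom, 0 < wA' K t τ v ∧ 0 < wB' K t τ v)
    (hRw' : ∀ K t, |t| ≤ l₀ → ∀ τ ∈ T K \ Bad K t, ∀ v ∈ dom,
      |Real.log (wB' K t τ v) - Real.log (wA' K t τ v) - cW' K t τ| ≤ RW' K t τ)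
    (hRRw' : ∀ K t, |t| ≤ l₀ → ∀ τ ∈ T K \ Bad K t, RW' K t τ ≤ vol * rw' K) (hrw' : Summable rw')
    (hsw' : Summable sw')
    (hWsc : ∀ K t, |t| ≤ l₀ → ∀ τ ∈ T K \ Bad K t, ∀ X ∈ wfac K t τ, sc X ≤ K)
    (hWsc₀ : ∀ K, ∀ X ∈ wfac₀ K, sc X ≤ K)
    (hWloc : ∀ K t, |t| ≤ l₀ → ∀ τ ∈ T K \ Bad K t, ∀ X ∈ wfac K t τ, X ∉ nf K t τ →
      vcA K t X = vcA K 0 X ∧ vcB K t X = vcB K 0 X)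
    (hWsize : ∀ K t, |t| ≤ l₀ → ∀ τ ∈ T K \ Bad K t, ∀ j ≤ K,
      ∑ X ∈ wfac K t τ with sc X = j, (|vcA K t X - vcA K 0 X| + |vcB K t X - vcB K 0 X|)
        ≤ vol * (Ew * a ^ (K - j)))
    (hWratet : ∀ K t, |t| ≤ l₀ → ∀ τ ∈ T K \ Bad K t, ∀ X ∈ wfac K t τ, X ∈ nf K t τ →
      |(vcB K t X - vcB K 0 X) - (vcA K t X - vcA K 0 X)| ≤ CrW * θ' ^ sc X * Real.exp (-(κ * dl X)))
    (hWMF : ∀ K t, |t| ≤ l₀ → ∀ τ ∈ T K \ Bad K t,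
      Multiplicity (nf K t τ) sc (fun X => Real.exp (-(κ * dl X))) CF vol Λg K)
    (hWwin : ∀ K t, |t| ≤ l₀ → ∀ τ ∈ T K \ Bad K t, ∀ X ∈ wfac K t τ, X ∉ wfac₀ K → jlogOf Cl K ≤ sc X)
    (hWwin₀ : ∀ K t, |t| ≤ l₀ → ∀ τ ∈ T K \ Bad K t, ∀ X ∈ wfac₀ K, X ∉ wfac K t τ → jlogOf Cl K ≤ sc X)
    (hWrate0 : ∀ K t, |t| ≤ l₀ → ∀ τ ∈ T K \ Bad K t, ∀ X ∈ wfac K t τ,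
      |vcB K 0 X - vcA K 0 X| ≤ CrW * θ' ^ sc X * Real.exp (-(κ * dl X)))
    (hWrate0' : ∀ K, ∀ X ∈ wfac₀ K, |vcB K 0 X - vcA K 0 X| ≤ CrW * θ' ^ sc X * Real.exp (-(κ * dl X)))
    (hWM : ∀ K t, |t| ≤ l₀ → ∀ τ ∈ T K \ Bad K t,
      Multiplicity (wfac K t τ) sc (fun X => Real.exp (-(κ * dl X))) Cw vol Λg K)
    (hWM₀ : ∀ K, Multiplicity (wfac₀ K) sc (fun X => Real.exp (-(κ * dl X))) Cw vol Λg K) :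
    ∃ δ : ℕ → ℝ, GoodClause l₀ vol T A B Bad δ ∧ Summable δ := by
  subst hflat
  have hL1 : 1 ≤ L := le_trans one_le_two hL
  have hε : 0 ≤ ε := hb.trans hbε
  exact goodClause_summable_of_route1_docked hL hN hθ hθ6 hb hbε hbs hε1 h2line hgc (gaugeAct_mem_flatOrbit N)
    (hmin_flatOrbit hL1 hε hb hc) (covRoot_flatOrbit hL1 hN hε b g hC hΛ₁ hΛ₂') hsector (flatCfg_mem_flatOrbit N) D sc dl hdl Fl admFl
    hΛ hω hinj hCd hθc hbox hgAW hgBW hθ' hθθ' hθ'1 h9 hU hG hP h5 hθ₅ hC₅ hθ₅' h9B hUBf hGB hPB h5B hθ₅B hC₅B hθ₅B'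
    h9R hUR' hGR hPR h5R hθ₅R hC₅R hθ₅R' M hMtwo planes hplanes famA famB ρA ρB UA UB lvlA lvlB Cst hθ'Λ hΛ1 hCl wA' wB' hO
    hsc hM hvol hE ha0 ha1 hSle hpend hBwin hMB hnpos hzA hzB hzAs hzBs hq hrsc hMR hbβ h031A h031B hgsA hgsB hR₁ hκ₀ hminA hQ
    hlift hminB hact hw₀ hAU hBU hPLA hetaA hPLB hetaB hTA hTB hε₁a VbA VbB hVbA hVbB hUA hUB hMc0 hMc hlvlA hlvlB hcoverA hcoverB
    hwinA hwinB hε₁ hε₁1 hsmall hβ₀ hβ₀1 hreprU hreprL hMvol hγ hrγ wfac nf wfac₀ vcA vcB hEw hCrW hwA hwB hw'pos hRw' hRRw' hrw'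
    hsw' hWsc hWsc₀ hWloc hWsize hWratet hWMF hWwin hWwin₀ hWrate0 hWrate0' hWM hWM₀

end

end Summit.QuantumFields.BalabanUV.T4Continuum.NE7Route1EndDockedFlatOrbit
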